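import Literature.Barriers.RiemannHypothesis.TuranPartialSumsDitheredTwist
import Literature.Analysis.Fourier.FejerSquareWave
import Mathlib.Analysis.Real.Pi.Bounds
import HarnessLib

/-!
# The Fejér profile of the dithered twist: finite frequency set, coefficients, and the prime-sum splitting

Barrier catalogue `Literature/Barriers/RiemannHypothesis/`, companion of `TuranPartialSumsDitheredTwist.lean`
(the dithered twist `ψ` of a `Profile`) and of `Literature/Analysis/Fourier/FejerSquareWave.lean`
(`r_J`, the Fejér means of the square wave, `|r_J| ≤ 1`). Definitions + theorems; no named facts.

With `r = (1 − δ) r_J` (`fejerProfile J δ`), the mean `m(x) = i e^{ix} r(x)` is a FINITE exponential sum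
`m(x) = Σ_{j < J'} α_j (e^{2i(j+1)x} − e^{−2ijx})`, `J' = ⌊(J+1)/2⌋`, `α_j = (1−δ)(2/π) c_{J,j}`
(`mean_fejerProfile_eq_sum`), since `i e^{ix} sin((2j+1)x) = (e^{i(2j+2)x} − e^{−2ijx})/2`. At a prime,
`x_p = (log p)/2` and `e^{2in x_p} = p^{in}`, so the prime sum of the twist SPLITS:

  `Σ_p ψ(p) p^{−s} = Σ_{n ∈ S_J} μ_n Σ_p p^{in−s} + A(s)`   (`Re s > 1`; `tsum_primes_twist_eq`),

with the frequency set `S_J = {1, …, J'} ∪ {0, −1, …, −(J'−1)}` (`freqSet J`), the real exponents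
`μ_n` (`freqCoeff J δ n`: `μ_{j+1} = α_j`, `μ_{−j} = −α_j`) and the dither series `A` of the companion
file. This is hypothesis `hsplit` of `Literature/NumberTheory/LFunctions/ShiftedZetaPowerProducts.lean`
(`LSeries_eq_eulerContinuation`), so that `Σ_n ψ(n) n^{−s}` continues as
`Π_{n ∈ S_J} ζ(s − in)^{μ_n} · e^{E(s)}` with FINITELY many branch points `1 + in`.

The exponents that matter (Montgomery's `b̂(1)`, `b̂(0)`):
`μ₁ = (1−δ)(2/π) J/(J+1)`, `μ₀ = −μ₁` (`freqCoeff_one`, `freqCoeff_zero`), all `|μ_n| ≤ (1−δ)(2/π) < 1`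
(`abs_freqCoeff_le`), `μ_n ≤ (1−δ)(2/π)/3 < μ₁` for `n ≠ 1` (`freqCoeff_le_of_ne`), and
`μ₁ − μ₀ − 1 = (1−δ)(4/π)J/(J+1) − 1 → 4/π − 1` (`exists_freqCoeff_gap`: for every `c < 4/π − 1` some
`J, δ` give `c < μ₁ − μ₀ − 1`), Montgomery's threshold ("`b̂(1) − b̂(0) − 1 → 4/π − 1` as `δ → 0`").

## References

* [Montgomery1983] H. L. Montgomery, *Zeros of approximations to the zeta function* (1983), §2
  (12)–(13) and Lemma 1; §4 (the choice `δ = Δ/4`).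
* [ZygmundFefferman2003] A. Zygmund, *Trigonometric Series*, Vol. I, Ch. III §3 (Fejér means).
-/

noncomputable section

open Complex Filter Topology Set Finset
open Literature.Analysis.Fourier

namespace Literature.Barriers.RiemannHypothesis

namespace DitheredTwist

/-! ### The Fejér profile -/

/-- **The Fejér profile** `r = (1 − δ) r_J`: `|r| ≤ 1 − δ`, Lipschitz constant `(1−δ)·3(J+1)/π`.
[cite: Montgomery1983, §2 (11)] -/
def fejerProfile (J : ℕ) (δ : ℝ) (hδ : 0 < δ) (hδ1 : δ < 1) : Profile where
  r x := (1 - δ) * fejerSquareWave J x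
  δ := δ
  L := (1 - δ) * (3 * ((J : ℝ) + 1) / Real.pi)
  δ_pos := hδ
  δ_lt_one := hδ1
  L_nonneg := mul_nonneg (by linarith) (by positivity)
  abs_le x := by
    rw [abs_mul, abs_of_nonneg (by linarith)]
    exact mul_le_of_le_one_right (by linarith) (abs_fejerSquareWave_le_one J x)
  lipschitz x y := by
    rw [← mul_sub, abs_mul, abs_of_nonneg (by linarith), mul_assoc]
    exact mul_le_mul_of_nonneg_left (abs_fejerSquareWave_sub_le J x y) (by linarith)

variable (J : ℕ) (δ : ℝ) (hδ : 0 < δ) (hδ1 : δ < 1)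

/-- Unfolding `r`. [folklore] -/
@[simp] theorem fejerProfile_r (x : ℝ) : (fejerProfile J δ hδ hδ1).r x = (1 - δ) * fejerSquareWave J x := rfl
/-- Unfolding `δ`. [folklore] -/
@[simp] theorem fejerProfile_δ : (fejerProfile J δ hδ hδ1).δ = δ := rfl

/-! ### The finite frequency set and the exponents -/

/-- Half the degree: `J' = ⌊(J+1)/2⌋`, the number of odd frequencies `2j+1 ≤ J`. [folklore] -/
def halfDeg : ℕ := (J + 1) / 2

/-- The coefficients `α_j = (1−δ)(2/π) c_{J,j}` (`j < J'`). [cite: Montgomery1983, §2 (13)] -/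
def alpha (j : ℕ) : ℝ := (1 - δ) * (2 / Real.pi) * fejerSqCoeff J j

/-- The frequency set `S_J = {1,…,J'} ∪ {0,−1,…,−(J'−1)}` ⊆ ℤ. [folklore] -/
def freqSet : Finset ℤ :=
  (Finset.range (halfDeg J)).image (fun j : ℕ ↦ (j : ℤ) + 1) ∪
    (Finset.range (halfDeg J)).image (fun j : ℕ ↦ -(j : ℤ))

/-- The exponents `μ_n`: `μ_{j+1} = α_j`, `μ_{−j} = −α_j` for `j < J'`, `0` otherwise.
[cite: Montgomery1983, §2 (13)] -/
def freqCoeff (n : ℤ) : ℝ :=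
  if 0 < n then (if (n - 1).toNat < halfDeg J then alpha J δ (n - 1).toNat else 0)
  else (if (-n).toNat < halfDeg J then -alpha J δ (-n).toNat else 0)

/-- `μ_{j+1} = α_j`. [folklore] -/
theorem freqCoeff_pos_index (j : ℕ) (hj : j < halfDeg J) : freqCoeff J δ ((j : ℤ) + 1) = alpha J δ j := by
  unfold freqCoeff
  rw [if_pos (by omega), show ((j : ℤ) + 1 - 1).toNat = j by omega, if_pos hj]

/-- `μ_{−j} = −α_j`. [folklore] -/
theorem freqCoeff_nonpos_index (j : ℕ) (hj : j < halfDeg J) : freqCoeff J δ (-(j : ℤ)) = -alpha J δ j := by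
  unfold freqCoeff
  rw [if_neg (by omega), show (-(-(j : ℤ))).toNat = j by omega, if_pos hj]

/-- `μ₁ = α₀ = (1−δ)(2/π) J/(J+1)` (for `J ≥ 1`). [cite: Montgomery1983, Lemma 1 (iv)] -/
theorem freqCoeff_one (hJ : 1 ≤ J) : freqCoeff J δ 1 = (1 - δ) * (2 / Real.pi) * ((J : ℝ) / ((J : ℝ) + 1)) := by
  have h := freqCoeff_pos_index J δ 0 (by unfold halfDeg; omega)
  simp only [Nat.cast_zero, zero_add] at h
  rw [h, alpha, fejerSqCoeff_zero]

/-- `μ₀ = −α₀ = −(1−δ)(2/π) J/(J+1)` (for `J ≥ 1`). [cite: Montgomery1983, Lemma 1 (iii)] -/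
theorem freqCoeff_zero (hJ : 1 ≤ J) : freqCoeff J δ 0 = -((1 - δ) * (2 / Real.pi) * ((J : ℝ) / ((J : ℝ) + 1))) := by
  have h := freqCoeff_nonpos_index J δ 0 (by unfold halfDeg; omega)
  simp only [Nat.cast_zero, neg_zero] at h
  rw [h, alpha, fejerSqCoeff_zero]

/-- `0 ≤ α_j ≤ (1−δ)(2/π)/(2j+1)`. [folklore] -/
theorem alpha_bounds (hδ1 : δ < 1) {j : ℕ} (hj : j < halfDeg J) :
    0 ≤ alpha J δ j ∧ alpha J δ j ≤ (1 - δ) * (2 / Real.pi) / (2 * j + 1) := by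
  have h0 : 0 ≤ (1 - δ) * (2 / Real.pi) := mul_nonneg (by linarith) (by positivity)
  unfold alpha
  refine ⟨mul_nonneg h0 (fejerSqCoeff_nonneg (mem_range.2 hj)), ?_⟩
  calc (1 - δ) * (2 / Real.pi) * fejerSqCoeff J j ≤ (1 - δ) * (2 / Real.pi) * (1 / (2 * j + 1)) :=
        mul_le_mul_of_nonneg_left fejerSqCoeff_le h0
    _ = (1 - δ) * (2 / Real.pi) / (2 * j + 1) := by ring

/-- **All exponents are small**: `|μ_n| ≤ (1−δ)(2/π) < 1`. [cite: Montgomery1983, Lemma 1] -/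
theorem abs_freqCoeff_le (hδ1 : δ < 1) (n : ℤ) : |freqCoeff J δ n| ≤ (1 - δ) * (2 / Real.pi) := by
  have h0 : 0 ≤ (1 - δ) * (2 / Real.pi) := mul_nonneg (by linarith) (by positivity)
  have key : ∀ j, j < halfDeg J → |alpha J δ j| ≤ (1 - δ) * (2 / Real.pi) := by
    intro j hj
    obtain ⟨ha, hb⟩ := alpha_bounds J δ hδ1 hj
    rw [abs_of_nonneg ha]
    refine hb.trans (div_le_self h0 ?_)
    have : (0 : ℝ) ≤ j := Nat.cast_nonneg j
    linarith
  unfold freqCoeff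
  split_ifs with h1 h2 h3
  · exact key _ h2
  · simp [h0]
  · rw [abs_neg]; exact key _ h3
  · simp [h0]

/-- `2/π < 1`. [folklore] -/
theorem two_div_pi_lt_one : 2 / Real.pi < 1 := by
  rw [div_lt_one Real.pi_pos]; linarith [Real.pi_gt_three]

/-- `|μ_n| < 1`. [cite: Montgomery1983, Lemma 1] -/
theorem abs_freqCoeff_lt_one (hδ : 0 < δ) (hδ1 : δ < 1) (n : ℤ) : |freqCoeff J δ n| < 1 := by
  refine (abs_freqCoeff_le J δ hδ1 n).trans_lt ?_
  have h1 := two_div_pi_lt_one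
  have h2 : 0 < 2 / Real.pi := by positivity
  nlinarith

/-- **The exponent `μ₁` dominates**: `μ_n ≤ (1−δ)(2/π)/3` for `n ≠ 1` (for `n = 0` because
`μ₀ = −α₀ ≤ 0`), while `μ₁ ≥ (1−δ)(2/π)/2` for `J ≥ 1`.
[cite: Montgomery1983, Lemma 1 ((ii): |b̂(k)| ≤ 1/3 for k ≠ 0, 1)] -/
theorem freqCoeff_le_of_ne (hδ1 : δ < 1) (n : ℤ) (h1 : n ≠ 1) :
    freqCoeff J δ n ≤ (1 - δ) * (2 / Real.pi) / 3 := by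
  have hc : 0 ≤ (1 - δ) * (2 / Real.pi) := mul_nonneg (by linarith) (by positivity)
  have hc3 : 0 ≤ (1 - δ) * (2 / Real.pi) / 3 := div_nonneg hc (by norm_num)
  unfold freqCoeff
  split_ifs with hp h2 h3
  · -- `n ≥ 2`: `α_{n−1} ≤ (1−δ)(2/π)/(2(n−1)+1) ≤ …/3`
    obtain ⟨-, hb⟩ := alpha_bounds J δ hδ1 h2
    refine hb.trans (div_le_div_of_nonneg_left hc (by norm_num) ?_)
    have : (1 : ℝ) ≤ (n - 1).toNat := by
      have : 1 ≤ (n - 1).toNat := by omega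
      exact_mod_cast this
    linarith
  · exact hc3
  · obtain ⟨ha, -⟩ := alpha_bounds J δ hδ1 h3
    linarith
  · exact hc3

/-- `μ₁ ≥ (1−δ)(2/π)/2` for `J ≥ 1`. [folklore] -/
theorem freqCoeff_one_ge (hδ1 : δ < 1) (hJ : 1 ≤ J) : (1 - δ) * (2 / Real.pi) / 2 ≤ freqCoeff J δ 1 := by
  rw [freqCoeff_one J δ hJ]
  have hc : 0 ≤ (1 - δ) * (2 / Real.pi) := mul_nonneg (by linarith) (by positivity)
  have hJ' : (1 : ℝ) / 2 ≤ (J : ℝ) / ((J : ℝ) + 1) := by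
    rw [div_le_div_iff₀ (by norm_num) (by positivity)]
    have : (1 : ℝ) ≤ J := by exact_mod_cast hJ
    linarith
  calc (1 - δ) * (2 / Real.pi) / 2 = (1 - δ) * (2 / Real.pi) * (1 / 2) := by ring
    _ ≤ (1 - δ) * (2 / Real.pi) * ((J : ℝ) / ((J : ℝ) + 1)) := mul_le_mul_of_nonneg_left hJ' hc

/-- **Montgomery's threshold**: for every `c < 4/π − 1` there are `J ≥ 1` and `δ ∈ (0, 1)` with
`c < μ₁ − μ₀ − 1 = (1−δ)(4/π) J/(J+1) − 1`. [cite: Montgomery1983, Lemma 1 (iii)–(iv) and §4] -/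
theorem exists_freqCoeff_gap {c : ℝ} (hc : c < 4 / Real.pi - 1) :
    ∃ J : ℕ, 1 ≤ J ∧ ∃ δ : ℝ, 0 < δ ∧ δ < 1 ∧
      c < freqCoeff J δ 1 - freqCoeff J δ 0 - 1 := by
  -- `μ₁ − μ₀ − 1 = (1−δ)(4/π)(1 − 1/(J+1)) − 1 ≥ (4/π)(1 − δ − 1/(J+1)) − 1`; take `δ = 1/(J+1)`, `J` large
  have hπ := Real.pi_pos
  have h4 : 0 < 4 / Real.pi := by positivity
  obtain ⟨J, hJ⟩ := exists_nat_gt (2 * (4 / Real.pi) / (4 / Real.pi - 1 - c))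
  have hgap : 0 < 4 / Real.pi - 1 - c := by linarith
  refine ⟨J + 1, by omega, 1 / ((J : ℝ) + 2), by positivity, by rw [div_lt_one (by positivity)]; linarith, ?_⟩
  rw [freqCoeff_one (J + 1) _ (by omega), freqCoeff_zero (J + 1) _ (by omega)]
  push_cast
  -- `(1 − 1/(J+2)) (4/π) (J+1)/(J+2) − 1 > c`
  have hJ2 : (0 : ℝ) < (J : ℝ) + 2 := by positivity
  have key : (1 - 1 / ((J : ℝ) + 2)) * ((J + 1 : ℝ) / ((J : ℝ) + 1 + 1)) ≥ 1 - 2 / ((J : ℝ) + 2) := by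
    rw [show ((J : ℝ) + 1 + 1) = (J : ℝ) + 2 by ring, ge_iff_le]
    rw [show (1 - 1 / ((J : ℝ) + 2)) * ((J + 1 : ℝ) / ((J : ℝ) + 2)) = ((J + 1 : ℝ) / ((J : ℝ) + 2)) ^ 2 by
      field_simp; ring]
    rw [show 1 - 2 / ((J : ℝ) + 2) = 1 - 2 * (1 / ((J : ℝ) + 2)) by ring]
    have hu : (J + 1 : ℝ) / ((J : ℝ) + 2) = 1 - 1 / ((J : ℝ) + 2) := by field_simp; ring
    rw [hu]
    nlinarith [sq_nonneg (1 / ((J : ℝ) + 2))]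
  have hJ' : 2 * (4 / Real.pi) / ((J : ℝ) + 2) < 4 / Real.pi - 1 - c := by
    rw [div_lt_iff₀ hJ2]
    have := (div_lt_iff₀ hgap).1 hJ
    nlinarith
  calc c < 4 / Real.pi * (1 - 2 / ((J : ℝ) + 2)) - 1 := by
        have : 4 / Real.pi * (1 - 2 / ((J : ℝ) + 2)) = 4 / Real.pi - 2 * (4 / Real.pi) / ((J : ℝ) + 2) := by ring
        rw [this]; linarith
    _ ≤ (1 - 1 / ((J : ℝ) + 2)) * (2 / Real.pi) * ((J + 1 : ℝ) / ((J : ℝ) + 1 + 1)) -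
          -((1 - 1 / ((J : ℝ) + 2)) * (2 / Real.pi) * ((J + 1 : ℝ) / ((J : ℝ) + 1 + 1))) - 1 := by
        have e : (1 - 1 / ((J : ℝ) + 2)) * (2 / Real.pi) * ((J + 1 : ℝ) / ((J : ℝ) + 1 + 1)) -
            -((1 - 1 / ((J : ℝ) + 2)) * (2 / Real.pi) * ((J + 1 : ℝ) / ((J : ℝ) + 1 + 1))) - 1 =
            4 / Real.pi * ((1 - 1 / ((J : ℝ) + 2)) * ((J + 1 : ℝ) / ((J : ℝ) + 1 + 1))) - 1 := by ring
        rw [e]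
        have := mul_le_mul_of_nonneg_left (ge_iff_le.1 key) h4.le
        linarith

/-! ### The mean as a finite exponential sum -/

/-- `i e^{ix} sin((2j+1)x) = (e^{i(2j+2)x} − e^{−2ijx})/2`. [folklore] -/
theorem I_mul_exp_mul_sin (x : ℝ) (j : ℕ) :
    I * exp (x * I) * (Real.sin ((2 * j + 1 : ℝ) * x) : ℂ) =
      (exp ((2 * ((j : ℝ) + 1) * x : ℝ) * I) - exp ((-(2 * (j : ℝ) * x) : ℝ) * I)) / 2 := by
  rw [ofReal_sin, Complex.sin]
  have hI : I * I = -1 := I_mul_I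
  -- expand and collect exponentials
  rw [show -(((2 * j + 1 : ℝ) * x : ℝ) : ℂ) * I = ((-(2 * (j : ℝ) * x) : ℝ) : ℂ) * I - (x : ℂ) * I by push_cast; ring,
    show (((2 * j + 1 : ℝ) * x : ℝ) : ℂ) * I = ((2 * ((j : ℝ) + 1) * x : ℝ) : ℂ) * I - (x : ℂ) * I by push_cast; ring,
    exp_sub, exp_sub]
  field_simp
  ring_nf
  rw [I_sq]; ring

/-- **The mean of the Fejér profile is a finite exponential sum**:
`m(x) = Σ_{j < J'} α_j (e^{2i(j+1)x} − e^{−2ijx})`. [cite: Montgomery1983, §2 (12)] -/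
theorem mean_fejerProfile_eq_sum (x : ℝ) :
    (fejerProfile J δ hδ hδ1).mean x =
      ∑ j ∈ Finset.range (halfDeg J), (alpha J δ j : ℂ) *
        (exp ((2 * ((j : ℝ) + 1) * x : ℝ) * I) - exp ((-(2 * (j : ℝ) * x) : ℝ) * I)) := by
  rw [Profile.mean, fejerProfile_r, fejerSquareWave]
  push_cast
  rw [Finset.mul_sum, Finset.mul_sum, Finset.mul_sum]
  refine Finset.sum_congr rfl fun j _ ↦ ?_
  have h := I_mul_exp_mul_sin x j
  rw [alpha, halfDeg] at *
  push_cast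
  calc I * exp (↑x * I) * ((1 - (δ : ℂ)) * (4 / (Real.pi : ℂ) * ((fejerSqCoeff J j : ℂ) * Complex.sin ((2 * (j : ℂ) + 1) * x))))
      = ((1 - (δ : ℂ)) * (4 / (Real.pi : ℂ)) * (fejerSqCoeff J j : ℂ)) *
          (I * exp (↑x * I) * (Real.sin ((2 * j + 1 : ℝ) * x) : ℂ)) := by
        rw [ofReal_sin]; push_cast; ring
    _ = ((1 - (δ : ℂ)) * (4 / (Real.pi : ℂ)) * (fejerSqCoeff J j : ℂ)) *
          ((exp ((2 * ((j : ℝ) + 1) * x : ℝ) * I) - exp ((-(2 * (j : ℝ) * x) : ℝ) * I)) / 2) := by rw [h]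
    _ = _ := by push_cast; ring

/-- At a prime: `e^{2in x_p} = p^{in}` (`x_p = (log p)/2`), in the form `e^{(c x) i} = p^{(c/2) i}` for
real `c`. [folklore] -/
theorem exp_phase_mul_eq_cpow {p : ℕ} (hp : 0 < p) (c : ℝ) :
    exp (((c * phase p : ℝ) : ℂ) * I) = (p : ℂ) ^ (((c / 2 : ℝ) : ℂ) * I) := by
  have hp0 : (p : ℂ) ≠ 0 := by exact_mod_cast hp.ne'
  rw [cpow_def_of_ne_zero hp0, ← ofReal_natCast, ← ofReal_log (Nat.cast_nonneg p), phase]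
  congr 1
  push_cast
  ring

/-- `p^{(n)i} · p^{−s} = p^{−(s − n i)}`. [folklore] -/
theorem cpow_mul_I_mul_cpow_neg {p : ℕ} (hp : 0 < p) (n s : ℂ) :
    (p : ℂ) ^ (n * I) * (p : ℂ) ^ (-s) = (p : ℂ) ^ (-(s - n * I)) := by
  have hp0 : (p : ℂ) ≠ 0 := by exact_mod_cast hp.ne'
  rw [← cpow_add _ _ hp0]; ring_nf

/-! ### The splitting of the prime sum -/

/-- The prime zeta summands `p^{−w}` are summable for `Re w > 1`. [folklore] -/
theorem summable_primes_cpow_neg {w : ℂ} (hw : 1 < w.re) : Summable fun p : Nat.Primes ↦ (p : ℂ) ^ (-w) := by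
  refine Summable.of_norm_bounded ((Nat.Primes.summable_rpow (r := -w.re)).2 (by linarith)) fun p ↦ ?_
  rw [norm_natCast_cpow_of_pos p.prop.pos, neg_re]

/-- **The prime sum of the Fejér-dithered twist splits**: for `Re s > 1`,
`Σ_p ψ(p) p^{−s} = Σ_{n ∈ S_J} μ_n Σ_p p^{−(s − in)} + A(s)`, the hypothesis `hsplit` of
`LSeries_eq_eulerContinuation` (`ShiftedZetaPowerProducts.lean`). [cite: Montgomery1983, §3 (14)–(16)] -/
theorem tsum_primes_twist_eq {s : ℂ} (hs : 1 < s.re) :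
    (∑' p : Nat.Primes, (fejerProfile J δ hδ hδ1).twist p * ((p : ℕ) : ℂ) ^ (-s)) =
      (∑ n ∈ freqSet J, (freqCoeff J δ n : ℂ) * ∑' p : Nat.Primes, ((p : ℕ) : ℂ) ^ (-(s - n * I))) +
        (fejerProfile J δ hδ hδ1).ditherSeries s := by
  set P : Profile := fejerProfile J δ hδ hδ1 with hP
  -- split `ψ(p) = m(x_p) + sign·w(x_p)`
  have hψ : ∀ p : Nat.Primes, P.twist p * ((p : ℕ) : ℂ) ^ (-s) =
      P.mean (phase p) * ((p : ℕ) : ℂ) ^ (-s) + (sign p : ℂ) * P.dither (phase p) * ((p : ℕ) : ℂ) ^ (-s) := by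
    intro p; rw [P.twist_prime p.prop, Profile.primeValue]; ring
  -- summability of both pieces (bounded by `p^{−σ}`)
  have hbd : ∀ {g : Nat.Primes → ℂ}, (∀ p, ‖g p‖ ≤ 1) →
      Summable fun p : Nat.Primes ↦ g p * ((p : ℕ) : ℂ) ^ (-s) := by
    intro g hg
    refine Summable.of_norm_bounded ((Nat.Primes.summable_rpow (r := -s.re)).2 (by linarith)) fun p ↦ ?_
    rw [norm_mul, norm_natCast_cpow_of_pos p.prop.pos, neg_re]
    exact mul_le_of_le_one_left (Real.rpow_nonneg (Nat.cast_nonneg _) _) (hg p)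
  have hs1 : Summable fun p : Nat.Primes ↦ P.mean (phase p) * ((p : ℕ) : ℂ) ^ (-s) := hbd fun p ↦ P.norm_mean_le _
  have hs2 : Summable fun p : Nat.Primes ↦ (sign p : ℂ) * P.dither (phase p) * ((p : ℕ) : ℂ) ^ (-s) := by
    refine hbd (g := fun p : Nat.Primes ↦ (sign p : ℂ) * P.dither (phase p)) fun p ↦ ?_
    rw [norm_mul]
    rcases sign_eq_or p with h | h <;> simp [h, P.norm_dither_le]
  rw [tsum_congr hψ, hs1.tsum_add hs2, P.tsum_primes_sign_dither_eq hs]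
  congr 1
  -- the mean part: expand and exchange the sums
  have hmean : ∀ p : Nat.Primes, P.mean (phase p) * ((p : ℕ) : ℂ) ^ (-s) =
      ∑ j ∈ Finset.range (halfDeg J), (alpha J δ j : ℂ) *
        (((p : ℕ) : ℂ) ^ (-(s - (((j : ℤ) + 1 : ℤ) : ℂ) * I)) - ((p : ℕ) : ℂ) ^ (-(s - ((-(j : ℤ) : ℤ) : ℂ) * I))) := by
    intro p
    rw [hP, mean_fejerProfile_eq_sum, Finset.sum_mul]
    refine Finset.sum_congr rfl fun j _ ↦ ?_
    have e1 : exp ((2 * ((j : ℝ) + 1) * phase p : ℝ) * I) = ((p : ℕ) : ℂ) ^ ((((j : ℤ) + 1 : ℤ) : ℂ) * I) := by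
      rw [exp_phase_mul_eq_cpow p.prop.pos]; congr 2; push_cast; ring
    have e2 : exp ((-(2 * (j : ℝ) * phase p) : ℝ) * I) = ((p : ℕ) : ℂ) ^ (((-(j : ℤ) : ℤ) : ℂ) * I) := by
      rw [show (-(2 * (j : ℝ) * phase p) : ℝ) = (-2 * (j : ℝ)) * phase p by ring, exp_phase_mul_eq_cpow p.prop.pos]
      congr 2; push_cast; ring
    rw [e1, e2, mul_assoc, sub_mul, cpow_mul_I_mul_cpow_neg p.prop.pos, cpow_mul_I_mul_cpow_neg p.prop.pos]
  rw [tsum_congr hmean]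
  have hsum_j : ∀ j ∈ Finset.range (halfDeg J), Summable fun p : Nat.Primes ↦ (alpha J δ j : ℂ) *
      (((p : ℕ) : ℂ) ^ (-(s - (((j : ℤ) + 1 : ℤ) : ℂ) * I)) - ((p : ℕ) : ℂ) ^ (-(s - ((-(j : ℤ) : ℤ) : ℂ) * I))) := by
    intro j _
    refine ((summable_primes_cpow_neg ?_).sub (summable_primes_cpow_neg ?_)).mul_left _ <;> simp [hs]
  rw [Summable.tsum_finsetSum hsum_j]
  -- evaluate the inner sums
  have hinner : ∀ j ∈ Finset.range (halfDeg J),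
      (∑' p : Nat.Primes, (alpha J δ j : ℂ) *
        (((p : ℕ) : ℂ) ^ (-(s - (((j : ℤ) + 1 : ℤ) : ℂ) * I)) - ((p : ℕ) : ℂ) ^ (-(s - ((-(j : ℤ) : ℤ) : ℂ) * I)))) =
      (alpha J δ j : ℂ) * (∑' p : Nat.Primes, ((p : ℕ) : ℂ) ^ (-(s - (((j : ℤ) + 1 : ℤ) : ℂ) * I))) -
        (alpha J δ j : ℂ) * (∑' p : Nat.Primes, ((p : ℕ) : ℂ) ^ (-(s - ((-(j : ℤ) : ℤ) : ℂ) * I))) := by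
    intro j _
    rw [tsum_mul_left, ← mul_sub, Summable.tsum_sub (summable_primes_cpow_neg (by simp [hs]))
      (summable_primes_cpow_neg (by simp [hs]))]
  rw [Finset.sum_congr rfl hinner, Finset.sum_sub_distrib]
  -- the frequency set is the disjoint union of the two images
  have hdisj : Disjoint ((Finset.range (halfDeg J)).image (fun j : ℕ ↦ (j : ℤ) + 1))
      ((Finset.range (halfDeg J)).image (fun j : ℕ ↦ -(j : ℤ))) := by
    rw [Finset.disjoint_left]
    intro n h1 h2
    rw [Finset.mem_image] at h1 h2
    obtain ⟨j, _, rfl⟩ := h1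
    obtain ⟨j', _, hj'⟩ := h2
    omega
  have hfreq : (∑ n ∈ freqSet J, (freqCoeff J δ n : ℂ) *
      ∑' p : Nat.Primes, ((p : ℕ) : ℂ) ^ (-(s - n * I))) =
      (∑ j ∈ Finset.range (halfDeg J), (alpha J δ j : ℂ) *
        ∑' p : Nat.Primes, ((p : ℕ) : ℂ) ^ (-(s - (((j : ℤ) + 1 : ℤ) : ℂ) * I))) -
      ∑ j ∈ Finset.range (halfDeg J), (alpha J δ j : ℂ) *
        ∑' p : Nat.Primes, ((p : ℕ) : ℂ) ^ (-(s - ((-(j : ℤ) : ℤ) : ℂ) * I)) := by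
    rw [freqSet, Finset.sum_union hdisj,
      Finset.sum_image (fun a _ b _ h ↦ by simpa using h),
      Finset.sum_image (fun a _ b _ h ↦ by simpa using h), sub_eq_add_neg, ← Finset.sum_neg_distrib]
    congr 1
    · refine Finset.sum_congr rfl fun j hj ↦ ?_
      rw [freqCoeff_pos_index J δ j (Finset.mem_range.1 hj)]
    · refine Finset.sum_congr rfl fun j hj ↦ ?_
      rw [freqCoeff_nonpos_index J δ j (Finset.mem_range.1 hj)]
      push_cast
      ring
  rw [hfreq]

end DitheredTwist

end Literature.Barriers.RiemannHypothesis

end
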